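import Summits.ResolutionOfSingularities.ResolutionOfSingularities.Theorems.WeightedInvariantHomogeneousOfSmoothInvariant
import Literature.AlgebraicGeometry.Resolution.StalkIdealLemmas
import Literature.AlgebraicGeometry.Resolution.MarkedIdealsLemmas
import Literature.AlgebraicGeometry.Resolution.AlterationsLemma32
import HarnessLib

/-!
# Stalk recipes compatible with smooth local homomorphisms give smooth-invariant ideal sheaves (hence `(hom)`)

Route `ResolutionOfSingularities/WeightedInvariant`, door crux `HypersurfaceCentreConstruction`
(stmt-ResolutionOfSingularities-19897), helper #6 (summit-side, OURS) — the bridge from the LOCAL clause (c11)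
«`ι`, `J` compatible with essentially smooth local homomorphisms of regular local rings» of the H2a‴ sketch
(`IotaJEssSmoothCompatible`, eft_sketch_v7) to the GLOBAL smooth-invariance hypothesis of helper #5
(`isHomogeneous_ideal_of_forall_comap_eq_of_smooth`), in the equation-free form (c12b) (recipes read the stalk
IDEAL `X_y`, not a chosen local equation):

* `stalkIdeal_comap_eq_recipe_of_smooth` — `Y` regular locally Noetherian, `g : T → Y` smooth, `Φ` a recipe
  `(R, I) ↦ Φ R I : Ideal R` with `Φ S' (I S') = (Φ S I) S'` for every local, formally smooth, essentially finite
  type `S → S'` between regular local rings, `K` an ideal sheaf with stalks `K_y = Φ(𝒪_{Y,y}, X_y)`: then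
  `(g*K)_t = Φ(𝒪_{T,t}, (g*X)_t)` (the stalk maps of a smooth morphism are such homomorphisms:
  `Scheme.Hom.smoothLocus_eq_top`, `LocallyOfFiniteType.stalkMap`; stalks of pull-backs are extended stalks,
  `stalkIdeal_comap_eq_map_stalkMap`);
* `recipeValue_comap_eq_of_smooth` — the same for a VALUE recipe `ι (R, I)` (e.g. the rank of [S1]):
  `ι(𝒪_{T,t}, (g*X)_t) = ι(𝒪_{Y,g t}, X_{g t})`;
* `comap_eq_comap_of_stalk_recipe` — hence `g₁*X = g₂*X ⇒ g₁*K = g₂*K` for smooth `g₁, g₂ : T → Y`;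
* `isHomogeneous_ideal_of_stalk_recipe` — hence `K(W)` is homogeneous for every `ℤʲ`-grading of an affine chart
  `W` making `X(W)` homogeneous (helper #5): sub-stub [S5] of the H2c″ assembly reduces to «the global centre of
  [S3] has stalks given by a (c11)-compatible recipe».

AI-written; weaker than expert review. References: EGA IV₄ 17.5.8 [Grothendieck1967]; J. Włodarczyk,
arXiv:2203.03090, Thm. 1.1.4 (6) [Wlodarczyk2022].
-/

noncomputable section

open CategoryTheory AlgebraicGeometry TopologicalSpace IsLocalRing
open Literature.AlgebraicGeometry.Resolution

set_option linter.dupNamespace false -- mandated namespace of this single-conjunct summit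

namespace Summit.ResolutionOfSingularities.ResolutionOfSingularities.Theorems

universe u v

section Stalk

variable {Y T : Scheme.{u}} [IsLocallyNoetherian Y]

/-- The stalk map of a smooth morphism at `t`, as an algebra structure `𝒪_{Y,g t} → 𝒪_{T,t}`, is a local,
formally smooth, essentially-of-finite-type homomorphism of regular local rings (when `Y` is regular).
Packaged as the data the recipes below quantify over. [cite: Grothendieck1967, Prop. 17.5.8 (iii) (PDF p. 69)] -/
theorem stalkMap_smooth_data (hY : Scheme.IsRegular Y) (g : T ⟶ Y) [Smooth g] (t : T) :
    letI : Algebra (Y.presheaf.stalk (g t)) (T.presheaf.stalk t) := (g.stalkMap t).hom.toAlgebra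
    IsRegularLocalRing (Y.presheaf.stalk (g t)) ∧ IsRegularLocalRing (T.presheaf.stalk t) ∧
      IsLocalHom (algebraMap (Y.presheaf.stalk (g t)) (T.presheaf.stalk t)) ∧
      Algebra.FormallySmooth (Y.presheaf.stalk (g t)) (T.presheaf.stalk t) ∧
      Algebra.EssFiniteType (Y.presheaf.stalk (g t)) (T.presheaf.stalk t) := by
  letI : Algebra (Y.presheaf.stalk (g t)) (T.presheaf.stalk t) := (g.stalkMap t).hom.toAlgebra
  refine ⟨hY _, Scheme.IsRegular.of_smooth g hY t, inferInstanceAs (IsLocalHom (g.stalkMap t).hom), ?_, ?_⟩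
  · have ht : t ∈ g.smoothLocus := by rw [g.smoothLocus_eq_top]; trivial
    exact (Scheme.Hom.mem_smoothLocus.mp ht : (g.stalkMap t).hom.FormallySmooth)
  · exact (LocallyOfFiniteType.stalkMap g t : (g.stalkMap t).hom.EssFiniteType)

/-- **Stalks of the pull-back of a recipe-defined ideal sheaf.** Let `Φ (R, I)` be an ideal-valued recipe compatible
with local, formally smooth, essentially-of-finite-type homomorphisms `S → S'` of regular local rings
(`Φ S' (I·S') = Φ S I · S'`), `Y` regular locally Noetherian, `g : T → Y` smooth, and `K` an ideal sheaf on `Y` with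
`K_y = Φ(𝒪_{Y,y}, X_y)` for all `y`. Then `(g*K)_t = Φ(𝒪_{T,t}, (g*X)_t)` for all `t`.
[cite: Grothendieck1967, Prop. 17.5.8 (iii) (PDF p. 69)] -/
theorem stalkIdeal_comap_eq_recipe_of_smooth (hY : Scheme.IsRegular Y) (g : T ⟶ Y) [Smooth g]
    (Φ : (R : Type u) → [CommRing R] → Ideal R → Ideal R)
    (hΦ : ∀ (S S' : Type u) [CommRing S] [CommRing S'] [IsRegularLocalRing S] [IsRegularLocalRing S']
      [Algebra S S'] [IsLocalHom (algebraMap S S')] [Algebra.FormallySmooth S S'] [Algebra.EssFiniteType S S']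
      (I : Ideal S), Φ S' (I.map (algebraMap S S')) = (Φ S I).map (algebraMap S S'))
    (X K : Y.IdealSheafData) (hK : ∀ y : Y, stalkIdeal K y = Φ (Y.presheaf.stalk y) (stalkIdeal X y))
    (t : T) : stalkIdeal (K.comap g) t = Φ (T.presheaf.stalk t) (stalkIdeal (X.comap g) t) := by
  letI : Algebra (Y.presheaf.stalk (g t)) (T.presheaf.stalk t) := (g.stalkMap t).hom.toAlgebra
  obtain ⟨h1, h2, h3, h4, h5⟩ := stalkMap_smooth_data hY g t
  haveI := h1; haveI := h2; haveI := h3; haveI := h4; haveI := h5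
  rw [stalkIdeal_comap_eq_map_stalkMap, stalkIdeal_comap_eq_map_stalkMap, hK]
  exact (hΦ (Y.presheaf.stalk (g t)) (T.presheaf.stalk t) (stalkIdeal X (g t))).symm

/-- **Values of a compatible recipe are constant along smooth pull-back**: for a value recipe `ι (R, I)` with
`ι S' (I·S') = ι S I` along local, formally smooth, essentially-of-finite-type homomorphisms of regular local rings,
`ι(𝒪_{T,t}, (g*X)_t) = ι(𝒪_{Y,g t}, X_{g t})` (the shape [S1] needs to pull the max-`ι` stratum back along the
torus-chart maps). [cite: Grothendieck1967, Prop. 17.5.8 (iii) (PDF p. 69)] -/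
theorem recipeValue_comap_eq_of_smooth (hY : Scheme.IsRegular Y) (g : T ⟶ Y) [Smooth g] {β : Type v}
    (ι : (R : Type u) → [CommRing R] → Ideal R → β)
    (hι : ∀ (S S' : Type u) [CommRing S] [CommRing S'] [IsRegularLocalRing S] [IsRegularLocalRing S']
      [Algebra S S'] [IsLocalHom (algebraMap S S')] [Algebra.FormallySmooth S S'] [Algebra.EssFiniteType S S']
      (I : Ideal S), ι S' (I.map (algebraMap S S')) = ι S I)
    (X : Y.IdealSheafData) (t : T) :
    ι (T.presheaf.stalk t) (stalkIdeal (X.comap g) t) = ι (Y.presheaf.stalk (g t)) (stalkIdeal X (g t)) := by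
  letI : Algebra (Y.presheaf.stalk (g t)) (T.presheaf.stalk t) := (g.stalkMap t).hom.toAlgebra
  obtain ⟨h1, h2, h3, h4, h5⟩ := stalkMap_smooth_data hY g t
  haveI := h1; haveI := h2; haveI := h3; haveI := h4; haveI := h5
  rw [stalkIdeal_comap_eq_map_stalkMap]
  exact hι (Y.presheaf.stalk (g t)) (T.presheaf.stalk t) (stalkIdeal X (g t))

/-- **A recipe-defined ideal sheaf is determined by `X` along smooth morphisms**: `g₁*X = g₂*X ⇒ g₁*K = g₂*K` for
smooth `g₁, g₂ : T → Y` (stalks agree by `stalkIdeal_comap_eq_recipe_of_smooth`; ideal sheaves are determined by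
their stalks). [folklore] -/
theorem comap_eq_comap_of_stalk_recipe (hY : Scheme.IsRegular Y)
    (Φ : (R : Type u) → [CommRing R] → Ideal R → Ideal R)
    (hΦ : ∀ (S S' : Type u) [CommRing S] [CommRing S'] [IsRegularLocalRing S] [IsRegularLocalRing S']
      [Algebra S S'] [IsLocalHom (algebraMap S S')] [Algebra.FormallySmooth S S'] [Algebra.EssFiniteType S S']
      (I : Ideal S), Φ S' (I.map (algebraMap S S')) = (Φ S I).map (algebraMap S S'))
    (X K : Y.IdealSheafData) (hK : ∀ y : Y, stalkIdeal K y = Φ (Y.presheaf.stalk y) (stalkIdeal X y))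
    (g₁ g₂ : T ⟶ Y) [Smooth g₁] [Smooth g₂] (h : X.comap g₁ = X.comap g₂) : K.comap g₁ = K.comap g₂ :=
  ext_of_forall_stalkIdeal_eq fun t => by
    rw [stalkIdeal_comap_eq_recipe_of_smooth hY g₁ Φ hΦ X K hK t,
      stalkIdeal_comap_eq_recipe_of_smooth hY g₂ Φ hΦ X K hK t, h]

end Stalk

/-- **`(hom)` for recipe-defined ideal sheaves** (H2c″ sub-stub [S5] in recipe form): on a regular locally
Noetherian `Y`, an ideal sheaf `K` whose stalks are `Φ(𝒪_{Y,y}, X_y)` for a recipe `Φ` compatible with local,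
formally smooth, essentially-of-finite-type homomorphisms of regular local rings has `K(W)` homogeneous for every
affine open `W` and every `ℤʲ`-grading of `Γ(Y, W)` making `X(W)` homogeneous
(`comap_eq_comap_of_stalk_recipe` + `isHomogeneous_ideal_of_forall_comap_eq_of_smooth`). [cite: Wlodarczyk2022, Thm. 1.1.4 (6)] -/
theorem isHomogeneous_ideal_of_stalk_recipe {Y : Scheme.{0}} [IsLocallyNoetherian Y] (hY : Scheme.IsRegular Y)
    (Φ : (R : Type) → [CommRing R] → Ideal R → Ideal R)
    (hΦ : ∀ (S S' : Type) [CommRing S] [CommRing S'] [IsRegularLocalRing S] [IsRegularLocalRing S']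
      [Algebra S S'] [IsLocalHom (algebraMap S S')] [Algebra.FormallySmooth S S'] [Algebra.EssFiniteType S S']
      (I : Ideal S), Φ S' (I.map (algebraMap S S')) = (Φ S I).map (algebraMap S S'))
    (X K : Y.IdealSheafData) (hK : ∀ y : Y, stalkIdeal K y = Φ (Y.presheaf.stalk y) (stalkIdeal X y))
    {j : ℕ} (W : Y.affineOpens) (𝒜 : (Fin j → ℤ) → AddSubgroup Γ(Y, W)) [GradedRing 𝒜]
    (hX : (X.ideal W).IsHomogeneous 𝒜) : (K.ideal W).IsHomogeneous 𝒜 :=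
  isHomogeneous_ideal_of_forall_comap_eq_of_smooth X K
    (fun _ _ g₁ g₂ _ _ h => comap_eq_comap_of_stalk_recipe hY Φ hΦ X K hK g₁ g₂ h) W 𝒜 hX

/-- **The `(hom)` clause of `IsAdmissibleCentre` for a Rees algebra with recipe-defined pieces**: if every piece
`Rₙ` has stalks `Φₙ(𝒪_{Y,y}, X_y)` for compatible recipes `Φₙ`, then on every affine `W` with a `ℤʲ`-grading making
`X(W)` homogeneous all `Rₙ(W)` are homogeneous (the degree-`0` condition on constants is accepted and not used).
[cite: Wlodarczyk2022, Thm. 1.1.4 (6)] -/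
theorem piece_isHomogeneous_of_stalk_recipe {k : Type} [Field k] {Y : Scheme.{0}} [IsLocallyNoetherian Y]
    (hY : Scheme.IsRegular Y) (f : Y ⟶ Spec (.of k)) (X : Y.IdealSheafData) (R : ReesAlgebraData Y)
    (Φ : ℕ → (S : Type) → [CommRing S] → Ideal S → Ideal S)
    (hΦ : ∀ (n : ℕ) (S S' : Type) [CommRing S] [CommRing S'] [IsRegularLocalRing S] [IsRegularLocalRing S']
      [Algebra S S'] [IsLocalHom (algebraMap S S')] [Algebra.FormallySmooth S S'] [Algebra.EssFiniteType S S']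
      (I : Ideal S), Φ n S' (I.map (algebraMap S S')) = (Φ n S I).map (algebraMap S S'))
    (hR : ∀ (n : ℕ) (y : Y), stalkIdeal (R.piece n) y = Φ n (Y.presheaf.stalk y) (stalkIdeal X y)) :
    ∀ (j : ℕ) (W : Y.affineOpens) (𝒜 : (Fin j → ℤ) → AddSubgroup Γ(Y, W)) [GradedRing 𝒜],
      (∀ c : Γ(Spec (.of k), ⊤), f.appLE ⊤ W le_top c ∈ 𝒜 0) → (X.ideal W).IsHomogeneous 𝒜 →
      ∀ n : ℕ, ((R.piece n).ideal W).IsHomogeneous 𝒜 :=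
  fun _ W 𝒜 _ _ hX n =>
    isHomogeneous_ideal_of_stalk_recipe hY (Φ n) (hΦ n) X (R.piece n) (hR n) W 𝒜 hX

end Summit.ResolutionOfSingularities.ResolutionOfSingularities.Theorems

end
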